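import Summits.Ventures.YMGap.Thresholds.SharpClusteringBochner
import HarnessLib

/-!
# Venture YMGap — static exponential clustering, Part I-c:
# the weighted energy estimate `K_c² ∫ Γ^w(u,u) e^S ≤ ∫ Γ^w(L_Su, L_Su) e^S`

HONEST FRAMING: venture file (cell `pub-ymgap`, track (a), seat lit-1); continuation of
`SharpClusteringBochner`. No physics and no number in this file.

Integrating the weighted curvature bound `Gam2W_ge` against `e^{S}σ^{⊗E}` (`∫ L_S(·) e^S = 0`,
`integral_exp_mul_Gam2W`) and applying the weighted Cauchy–Schwarz inequality
(`abs_integral_exp_mul_GamW_le`) gives `weightedEnergy_le`: for `K_c = N/2 - Λ - (√ρ-1)H ≥ 0` and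
every smooth `u`, `K_c² ∫ Γ^w(u,u) e^S dσ^{⊗E} ≤ ∫ Γ^w(L_Su, L_Su) e^S dσ^{⊗E}`. With
`w_e = exp(2c·dist(e, Λ_g))` and `u` an approximate solution of the Poisson equation `L_S u = g - ⟨g⟩`
(Part II), this says that `∇u` is exponentially small far from `Λ_g` — the static substitute for the
finite speed of propagation of the Langevin dynamics in Shen–Zhu–Zhu's proof of Cor. 4.11.

## References

* H. Shen, R. Zhu, X. Zhu, CMP 400 (2023) 805–851 = arXiv:2204.12737v1, Cor. 4.11, Remark 4.6.
* B. Helffer, J. Funct. Anal. 155 (1998) 571–586 (method).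
-/

noncomputable section

open scoped Matrix ComplexConjugate BigOperators Matrix.Norms.Frobenius ContDiff Topology
open Matrix Complex Finset MeasureTheory
open Literature.MathematicalPhysics.QuantumFieldTheory
open Literature.MathematicalPhysics.QuantumFieldTheory.SUNBakryEmery
  (FrameIdx frame frame_conjTranspose frame_trace frameGrad frameGrad_conjTranspose frameGrad_trace
   frobNorm_frameGrad_sq conjTranspose_comm_of_skew trace_comm)

namespace Summit.Ventures.YMGap

namespace SharpClustering

open LatticeBakryEmery

universe u

variable {ι : Type u} [Fintype ι] [DecidableEq ι] {N : ℕ}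

/-! ### Integration against `e^{S} σ^{⊗E}`: the weighted energy estimate -/

/-- `∫ Γ₂^w(u) e^S dσ^{⊗E} = -∫ Γ^w(u, L_Su) e^S dσ^{⊗E}` (since `∫ L_S(·) e^S = 0`). -/
theorem integral_exp_mul_Gam2W (hN : N ≠ 0) (w : ι → ℝ) {S u : Cfg ι N → ℝ} (hS : ContDiff ℝ ∞ S)
    (hu : ContDiff ℝ ∞ u) :
    ∫ g : PSU ι N, Real.exp (S (emb g)) * Gam2W w S u (emb g) ∂(haarPi ι N) =
      -∫ g : PSU ι N, Real.exp (S (emb g)) * GamW w u (genL S u) (emb g) ∂(haarPi ι N) := by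
  have h1 : ∫ g : PSU ι N, Real.exp (S (emb g)) * genL S (GamW w u u) (emb g) ∂(haarPi ι N) = 0 :=
    integral_exp_mul_genL_eq_zero hN hS (contDiff_GamW w hu hu)
  have h3 : ∫ g : PSU ι N, Real.exp (S (emb g)) * Gam2W w S u (emb g) ∂(haarPi ι N) =
      (1 / 2) * ∫ g : PSU ι N, Real.exp (S (emb g)) * genL S (GamW w u u) (emb g) ∂(haarPi ι N) -
        ∫ g : PSU ι N, Real.exp (S (emb g)) * GamW w u (genL S u) (emb g) ∂(haarPi ι N) := by
    rw [← integral_const_mul, ← integral_sub]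
    · refine integral_congr_ae (ae_of_all _ fun g => ?_)
      simp only [Gam2W]
      ring
    · exact (integrable_of_continuous_PSU (continuous_restrict (hS.exp.mul (contDiff_genL hS
        (contDiff_GamW w hu hu)))) _).const_mul _
    · exact integrable_of_continuous_PSU (continuous_restrict (hS.exp.mul (contDiff_GamW w hu (contDiff_genL hS hu)))) _
  rw [h3, h1, mul_zero, zero_sub]

omit [DecidableEq ι] in
/-- Square roots of products with the weight. -/
private theorem sqrt_mul_sqrt_exp (x y : ℝ) (hx : 0 ≤ x) (s : ℝ) :
    Real.sqrt (Real.exp s * x) * Real.sqrt (Real.exp s * y) = Real.exp s * Real.sqrt (x * y) := by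
  rw [← Real.sqrt_mul (mul_nonneg (Real.exp_pos s).le hx),
    show Real.exp s * x * (Real.exp s * y) = Real.exp s ^ 2 * (x * y) by ring,
    Real.sqrt_mul (sq_nonneg _), Real.sqrt_sq (Real.exp_pos s).le]

/-- **Weighted Cauchy–Schwarz for `Γ^w`**:
`|∫ e^S Γ^w(u,v)| ≤ (∫ e^S Γ^w(u,u))^{1/2} (∫ e^S Γ^w(v,v))^{1/2}` (nonnegative weights). -/
theorem abs_integral_exp_mul_GamW_le {w : ι → ℝ} (hw : ∀ e, 0 ≤ w e) {S u v : Cfg ι N → ℝ}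
    (hS : ContDiff ℝ ∞ S) (hu : ContDiff ℝ ∞ u) (hv : ContDiff ℝ ∞ v) (μ : Measure (PSU ι N)) [IsFiniteMeasure μ] :
    |∫ g : PSU ι N, Real.exp (S (emb g)) * GamW w u v (emb g) ∂μ| ≤
      Real.sqrt (∫ g : PSU ι N, Real.exp (S (emb g)) * GamW w u u (emb g) ∂μ) *
        Real.sqrt (∫ g : PSU ι N, Real.exp (S (emb g)) * GamW w v v (emb g) ∂μ) := by
  have hSc := continuous_restrict hS
  have hwu : Continuous fun g : PSU ι N => Real.sqrt (Real.exp (S (emb g)) * GamW w u u (emb g)) :=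
    Real.continuous_sqrt.comp ((Real.continuous_exp.comp hSc).mul (continuous_restrict (contDiff_GamW w hu hu)))
  have hwv : Continuous fun g : PSU ι N => Real.sqrt (Real.exp (S (emb g)) * GamW w v v (emb g)) :=
    Real.continuous_sqrt.comp ((Real.continuous_exp.comp hSc).mul (continuous_restrict (contDiff_GamW w hv hv)))
  have h := abs_integral_mul_le_sqrt hwu hwv μ
  have hnu : ∀ g : PSU ι N, 0 ≤ Real.exp (S (emb g)) * GamW w u u (emb g) := fun g =>
    mul_nonneg (Real.exp_pos _).le (GamW_self_nonneg hw _ _)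
  have hnv : ∀ g : PSU ι N, 0 ≤ Real.exp (S (emb g)) * GamW w v v (emb g) := fun g =>
    mul_nonneg (Real.exp_pos _).le (GamW_self_nonneg hw _ _)
  simp only [Real.sq_sqrt (hnu _), Real.sq_sqrt (hnv _)] at h
  refine le_trans ?_ ((le_abs_self _).trans h)
  calc |∫ g : PSU ι N, Real.exp (S (emb g)) * GamW w u v (emb g) ∂μ|
      ≤ ∫ g : PSU ι N, |Real.exp (S (emb g)) * GamW w u v (emb g)| ∂μ := abs_integral_le_integral_abs
    _ ≤ ∫ g : PSU ι N, Real.sqrt (Real.exp (S (emb g)) * GamW w u u (emb g)) *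
          Real.sqrt (Real.exp (S (emb g)) * GamW w v v (emb g)) ∂μ := by
        refine integral_mono (integrable_of_continuous_PSU ((Real.continuous_exp.comp hSc).mul
          (continuous_restrict (contDiff_GamW w hu hv))).abs μ) (integrable_of_continuous_PSU (hwu.mul hwv) μ)
          fun g => ?_
        rw [sqrt_mul_sqrt_exp _ _ (GamW_self_nonneg hw _ _), abs_mul,
          abs_of_pos (Real.exp_pos _)]
        have hG := abs_GamW_le hw u v (emb g)
        rw [← Real.sqrt_mul (GamW_self_nonneg hw _ _)] at hG
        exact mul_le_mul_of_nonneg_left hG (Real.exp_pos _).le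

/-- **The weighted energy estimate.** Under the hypotheses of `Gam2W_ge` with
`K_c := N/2 - Λ - (√ρ - 1)H ≥ 0`, every smooth `u` satisfies
`K_c² ∫ Γ^w(u,u) e^S dσ^{⊗E} ≤ ∫ Γ^w(L_Su, L_Su) e^S dσ^{⊗E}`: in the weighted norm, the gradient of
`u` is controlled by the gradient of `L_S u`. Applied (Part III) with `w_e = exp(2c·dist(e, Λ_g))` to
approximate solutions of `L_S u = g - ⟨g⟩`, whose right side has gradient supported in `Λ_g`, this says
that `∇u` is exponentially small far from `Λ_g` — the static substitute for the finite speed of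
propagation of the Langevin dynamics in Shen–Zhu–Zhu's proof of Cor. 4.11. -/
theorem weightedEnergy_le (hN : N ≠ 0) {S u : Cfg ι N → ℝ} (hS : ContDiff ℝ ∞ S) (hu : ContDiff ℝ ∞ u)
    {Λ H ρ : ℝ} {h : ι → ι → ℝ} {w : ι → ℝ} (hHess : HessBound S Λ) (hOff : OffDiagHessBound S h)
    (hh0 : ∀ e e', 0 ≤ h e e') (hsymm : ∀ e e', h e e' = h e' e) (hrow : ∀ e, ∑ e', h e e' ≤ H)
    (hρ : 1 ≤ ρ) (hw : AdmissibleWeights h ρ w) (hK : 0 ≤ (N : ℝ) / 2 - Λ - (Real.sqrt ρ - 1) * H) :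
    ((N : ℝ) / 2 - Λ - (Real.sqrt ρ - 1) * H) ^ 2 *
        ∫ g : PSU ι N, Real.exp (S (emb g)) * GamW w u u (emb g) ∂(haarPi ι N) ≤
      ∫ g : PSU ι N, Real.exp (S (emb g)) * GamW w (genL S u) (genL S u) (emb g) ∂(haarPi ι N) := by
  set K := (N : ℝ) / 2 - Λ - (Real.sqrt ρ - 1) * H with hKdef
  have hw0 : ∀ e, 0 ≤ w e := fun e => (hw.1 e).le
  set A := ∫ g : PSU ι N, Real.exp (S (emb g)) * GamW w u u (emb g) ∂(haarPi ι N) with hA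
  set B := ∫ g : PSU ι N, Real.exp (S (emb g)) * GamW w (genL S u) (genL S u) (emb g) ∂(haarPi ι N) with hB
  have hA0 : 0 ≤ A := integral_nonneg fun g => mul_nonneg (Real.exp_pos _).le (GamW_self_nonneg hw0 _ _)
  have hB0 : 0 ≤ B := integral_nonneg fun g => mul_nonneg (Real.exp_pos _).le (GamW_self_nonneg hw0 _ _)
  -- `K A ≤ ∫ e^S Γ₂^w = -∫ e^S Γ^w(u, Lu) ≤ √A √B`
  have hKA : K * A ≤ Real.sqrt A * Real.sqrt B := by
    have h1 : K * A ≤ ∫ g : PSU ι N, Real.exp (S (emb g)) * Gam2W w S u (emb g) ∂(haarPi ι N) := by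
      rw [hA, ← integral_const_mul]
      refine integral_mono ?_ ?_ fun g => ?_
      · exact (integrable_of_continuous_PSU (continuous_restrict (hS.exp.mul (contDiff_GamW w hu hu))) _).const_mul _
      · exact integrable_of_continuous_PSU (continuous_restrict (hS.exp.mul (contDiff_Gam2W w hS hu))) _
      · have h := Gam2W_ge hN hS hu hHess hOff hh0 hsymm hrow hρ hw g
        have hpos := Real.exp_pos (S (emb g))
        calc K * (Real.exp (S (emb g)) * GamW w u u (emb g))
            = Real.exp (S (emb g)) * (K * GamW w u u (emb g)) := by ring
          _ ≤ Real.exp (S (emb g)) * Gam2W w S u (emb g) := mul_le_mul_of_nonneg_left h hpos.le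
    rw [integral_exp_mul_Gam2W hN w hS hu] at h1
    have h2 := abs_integral_exp_mul_GamW_le hw0 hS hu (contDiff_genL hS hu) (haarPi ι N)
    have h3 := neg_abs_le (∫ g : PSU ι N, Real.exp (S (emb g)) * GamW w u (genL S u) (emb g) ∂(haarPi ι N))
    linarith
  -- conclude `K² A ≤ B`
  by_cases hA1 : A = 0
  · rw [hA1, mul_zero]; exact hB0
  have hApos : 0 < A := lt_of_le_of_ne hA0 (Ne.symm hA1)
  have hsA : 0 < Real.sqrt A := Real.sqrt_pos.2 hApos
  have hKs : K * Real.sqrt A ≤ Real.sqrt B := by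
    have : K * Real.sqrt A * Real.sqrt A ≤ Real.sqrt B * Real.sqrt A := by
      rw [mul_assoc, Real.mul_self_sqrt hA0, mul_comm (Real.sqrt B)]; exact hKA
    exact le_of_mul_le_mul_right this hsA
  have hKs0 : 0 ≤ K * Real.sqrt A := mul_nonneg hK hsA.le
  calc K ^ 2 * A = (K * Real.sqrt A) ^ 2 := by rw [mul_pow, Real.sq_sqrt hA0]
    _ ≤ Real.sqrt B ^ 2 := pow_le_pow_left₀ hKs0 hKs 2
    _ = B := Real.sq_sqrt hB0


end SharpClustering

end Summit.Ventures.YMGap
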